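import Summits.CriticalPhenomena.SAWScalingLimit.Theses.SAWBrickWallHomotopy
import Summits.CriticalPhenomena.SAWScalingLimit.Theorems.SubseqIdentification.Negative.CompactContainerZd
import Summits.CriticalPhenomena.SAWScalingLimit.Theorems.IsingBoundaryRatio.Negative.IsingBoundaryRatioNesting
import Literature.Probability.RandomPlanarGeometry.SLEConvergenceCriterion
import Literature.Probability.LatticeModels.MeshColumns
import Literature.Probability.LatticeModels.TriangularLatticeProofs
import Literature.Probability.Percolation.CLE6Proofs
import Literature.Probability.Percolation.TriLoopWinding
import HarnessLib

/-!
# `ModulusUniversality`, line `birth`: stub N₁ — escaping mass along the mesh filter, and the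
lattice geometry separating `ℤ²` polylines from stretched honeycomb polylines

Helper file (`--supports stmt-CriticalPhenomena-5790`) of the line `birth` / `registered` for the
crux `SAWBrickWallHomotopy.ModulusUniversality` (skeleton
`Summits/CriticalPhenomena/SAWScalingLimit/Cruxes/ModulusUniversality/Lines/birth.lean`), wave 2,
NECESSITY direction "the crux implies tightness of the critical `ℤ²` SAW laws" (stub N₂,
`z2Tight_of_modulusUniversality`, file `SAWBrickWallHomotopyModulusUniversalityImpliesZ2Tight.lean`).
This file proves the registered sub-goal N₁ and the model-specific geometry N₂ consumes:

* `frequently_thickening_compl_of_not_isTightAlongMesh` (registered stub N₁): if the critical `δℤ²`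
  SAW curve laws of an endpoint approximation are not tight along `δ → 0⁺` (`IsTightAlongMesh`,
  `SLEConvergenceCriterion.lean`), then some `ε, η > 0` are such that for EVERY finite set `S` of
  curve classes, frequently as `δ → 0⁺`, the pushed law charges the complement of the
  `η`-thickening of `S` with mass `> ε` — the `η`-ball criterion for tightness on the complete
  space `CurveClass ℂ` run along the mesh filter (one finite set and one threshold per level
  `1/(m+1)`, compact containers `exists_isCompact_forall_curve_mem_zd` for the meshes above the
  threshold, a closed totally bounded diagonal intersection);
* `map_curve_ne_curve`: a `ℤ²` SAW class is never the image of a honeycomb SAW class with at least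
  two steps under a diagonal map `Φ = diag(r₁, r₂)` — the `ℤ²` trace lies on the grid lines
  (`range_curve_subset_gridLines`), no honeycomb edge is horizontal (`im_hexCenter_sub_ne_zero`),
  of two consecutive honeycomb edges one is not vertical (`re_hexCenter_sub_ne_zero_or`), and a
  slanted segment is not covered by countably many axis-parallel lines (`not_forall_mem_gridLines`,
  Lebesgue measure of `[0,1]`).

Everything is soft analysis / lattice bookkeeping, tagged [folklore]; `eventually_ne` and
`hexCenter_re/im` are reused from the tree.
-/

noncomputable section

open MeasureTheory Filter Topology
open scoped ENNReal NNReal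
open Literature.Probability.LatticeModels
open Literature.Probability.RandomPlanarGeometry

namespace Summit.CriticalPhenomena.SAWScalingLimit.Cruxes.ModulusUniversality.Birth

open Summit.CriticalPhenomena.SAWScalingLimit.Theorems.SubseqIdentification.Negative
  (exists_isCompact_forall_curve_mem_zd)
open Summit.CriticalPhenomena.SAWScalingLimit.Theorems.IsingBoundaryRatio.Negative (eventually_ne)
open Literature.Probability.Percolation (hexCenter_re hexCenter_im)

/-! ### Escaping mass along the mesh filter (registered stub N₁) -/

/-- **Stub N₁ — escaping mass along the mesh filter.** If the critical `δℤ²` SAW curve laws of an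
endpoint approximation are NOT tight along `δ → 0⁺` (`IsTightAlongMesh`), then for some `ε, η > 0`
no finite set of curve classes captures, within distance `η`, all but `ε` of the mass for all small
meshes: for every finite `S`, frequently as `δ → 0⁺` the pushed law gives mass `> ε` to the
complement of the `η`-thickening of `S`. Contrapositive of the `η`-ball criterion for tightness on
the complete space `CurveClass ℂ`, run along the mesh filter: at level `m` a finite set `S_m` works
below a threshold `θ_m` with defect `ε 2^{-(m+1)}`, the compact container of all SAW classes at
meshes in `[θ_m, δ₁]` (`exists_isCompact_forall_curve_mem_zd`) covers the rest, and
`⋂_m (cthickening (1/(m+1)) S_m ∪ C_m)` is closed and totally bounded, hence compact. [folklore] -/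
theorem frequently_thickening_compl_of_not_isTightAlongMesh : ∀ (D : DobrushinDomain) (a b : ℝ → Site 2), SAW.IsEndpointApprox D a b → ¬ IsTightAlongMesh (fun δ (γ : SAW.DomainSAW D.carrier δ (a δ) (b δ)) => γ.curve) (fun δ => SAW.law D.carrier δ (a δ) (b δ)) → ∃ ε : ENNReal, 0 < ε ∧ ∃ η : ℝ, 0 < η ∧ ∀ S : Finset (CurveClass ℂ), ∃ᶠ δ in nhdsWithin 0 (Set.Ioi 0), ε < ((SAW.law D.carrier δ (a δ) (b δ)).map (fun γ => γ.curve)) (Metric.thickening η (S : Set (CurveClass ℂ)))ᶜ := by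
  intro D a b hab hnt
  by_contra H
  apply hnt
  -- `H`, negated: every `ε, η > 0` admit a finite set capturing all but `ε` of the mass within
  -- distance `η`, for all small meshes
  have H' : ∀ ε : ℝ≥0∞, 0 < ε → ∀ η : ℝ, 0 < η → ∃ S : Finset (CurveClass ℂ),
      ∀ᶠ δ in 𝓝[>] (0 : ℝ), SAW.law D.carrier δ (a δ) (b δ)
        ((fun γ : SAW.DomainSAW D.carrier δ (a δ) (b δ) => γ.curve) ⁻¹'
          (Metric.thickening η (S : Set (CurveClass ℂ)))ᶜ) ≤ ε := by
    intro ε hε η hη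
    obtain ⟨S, hS⟩ : ∃ S : Finset (CurveClass ℂ), ¬ ∃ᶠ δ in 𝓝[>] (0 : ℝ),
        ε < ((SAW.law D.carrier δ (a δ) (b δ)).map (fun γ => γ.curve))
          (Metric.thickening η (S : Set (CurveClass ℂ)))ᶜ := by
      by_contra h'
      push Not at h'
      exact H ⟨ε, hε, η, hη, h'⟩
    refine ⟨S, ?_⟩
    rw [Filter.not_frequently] at hS
    filter_upwards [hS] with δ hδ
    rw [not_lt, Measure.map_apply (SAW.DomainSAW.measurable_of_top _)
      Metric.isOpen_thickening.measurableSet.compl] at hδ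
    exact hδ
  intro ε hε
  rcases eq_or_ne ε ⊤ with rfl | hεtop
  · exact ⟨∅, isCompact_empty, Eventually.of_forall fun _ => le_top⟩
  -- level `m`: radius `1/(m+1)`, mass defect `ε 2⁻¹^(m+1)` below the threshold `θ m`
  have hlev : ∀ m : ℕ, ∃ S : Finset (CurveClass ℂ), ∃ θ : ℝ, 0 < θ ∧ ∀ δ ∈ Set.Ioo (0 : ℝ) θ,
      SAW.law D.carrier δ (a δ) (b δ)
        ((fun γ : SAW.DomainSAW D.carrier δ (a δ) (b δ) => γ.curve) ⁻¹'
          (Metric.thickening (1 / ((m : ℝ) + 1)) (S : Set (CurveClass ℂ)))ᶜ) ≤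
        ε * 2⁻¹ ^ (m + 1) := by
    intro m
    obtain ⟨S, hS⟩ := H' (ε * 2⁻¹ ^ (m + 1))
      (ENNReal.mul_pos hε.ne' (pow_ne_zero _ (ENNReal.inv_ne_zero.2 ENNReal.ofNat_ne_top)))
      (1 / ((m : ℝ) + 1)) Nat.one_div_pos_of_nat
    obtain ⟨θ, hθ, hsub⟩ := mem_nhdsGT_iff_exists_Ioo_subset.1 hS
    exact ⟨S, θ, hθ, fun δ hδ => hsub hδ⟩
  choose S θ hθ hSθ using hlev
  -- distinct endpoints on `(0, δ₁)`, and compact containers for the meshes in `[θ m, δ₁]`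
  obtain ⟨δ₁, hδ₁, hδ₁sub⟩ :=
    mem_nhdsGT_iff_exists_Ioo_subset.1 (eventually_ne hab)
  have hC : ∀ m : ℕ, ∃ C : Set (CurveClass ℂ), IsCompact C ∧ ∀ δ ∈ Set.Icc (θ m) δ₁,
      ∀ u v : Site 2, u ≠ v → ∀ γ : SAW.DomainSAW D.carrier δ u v, γ.curve ∈ C := fun m =>
    exists_isCompact_forall_curve_mem_zd D.isBounded (hθ m)
  choose C hCc hCmem using hC
  set A : ℕ → Set (CurveClass ℂ) := fun m =>
    Metric.cthickening (1 / ((m : ℝ) + 1)) (S m : Set (CurveClass ℂ)) ∪ C m with hA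
  set K : Set (CurveClass ℂ) := ⋂ m, A m with hK
  have hKc : IsClosed K :=
    isClosed_iInter fun m => Metric.isClosed_cthickening.union (hCc m).isClosed
  have hKtb : TotallyBounded K := by
    refine Metric.totallyBounded_iff.2 fun r hr => ?_
    obtain ⟨m, hm⟩ := exists_nat_one_div_lt hr
    obtain ⟨t, htfin, htcov⟩ := Metric.totallyBounded_iff.1 (hCc m).totallyBounded r hr
    refine ⟨(S m : Set (CurveClass ℂ)) ∪ t, (S m).finite_toSet.union htfin, fun x hx => ?_⟩
    rcases Set.mem_iInter.1 hx m with hx1 | hx2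
    · have hx1' : x ∈ Metric.thickening r (S m : Set (CurveClass ℂ)) :=
        Metric.cthickening_subset_thickening' hr hm _ hx1
      rw [Metric.thickening_eq_biUnion_ball] at hx1'
      obtain ⟨y, hy, hxy⟩ := Set.mem_iUnion₂.1 hx1'
      exact Set.mem_iUnion₂.2 ⟨y, Or.inl hy, hxy⟩
    · obtain ⟨y, hy, hxy⟩ := Set.mem_iUnion₂.1 (htcov hx2)
      exact Set.mem_iUnion₂.2 ⟨y, Or.inr hy, hxy⟩
  refine ⟨K, isCompact_iff_totallyBounded_isComplete.2 ⟨hKtb, hKc.isComplete⟩, ?_⟩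
  filter_upwards [Ioo_mem_nhdsGT hδ₁] with δ hδ
  show SAW.law D.carrier δ (a δ) (b δ)
    ((fun γ : SAW.DomainSAW D.carrier δ (a δ) (b δ) => γ.curve) ⁻¹' Kᶜ) ≤ ε
  have hpre : (fun γ : SAW.DomainSAW D.carrier δ (a δ) (b δ) => γ.curve) ⁻¹' Kᶜ =
      ⋃ m, (fun γ : SAW.DomainSAW D.carrier δ (a δ) (b δ) => γ.curve) ⁻¹' (A m)ᶜ := by
    rw [hK, Set.compl_iInter, Set.preimage_iUnion]
  rw [hpre]
  refine (measure_iUnion_le _).trans ?_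
  have hbound : ∀ m, SAW.law D.carrier δ (a δ) (b δ)
      ((fun γ : SAW.DomainSAW D.carrier δ (a δ) (b δ) => γ.curve) ⁻¹' (A m)ᶜ) ≤
        ε * 2⁻¹ ^ (m + 1) := by
    intro m
    rcases lt_or_ge δ (θ m) with hlt | hle
    · refine (measure_mono ?_).trans (hSθ m δ ⟨hδ.1, hlt⟩)
      refine Set.preimage_mono (Set.compl_subset_compl.2 ?_)
      exact (Metric.thickening_subset_cthickening _ _).trans Set.subset_union_left
    · have hne : a δ ≠ b δ := hδ₁sub hδ
      have hempty : (fun γ : SAW.DomainSAW D.carrier δ (a δ) (b δ) => γ.curve) ⁻¹' (A m)ᶜ = ∅ :=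
        Set.eq_empty_of_forall_notMem fun γ hγ =>
          hγ (Or.inr (hCmem m δ ⟨hle, hδ.2.le⟩ _ _ hne γ))
      rw [hempty, measure_empty]
      exact bot_le
  calc ∑' m, SAW.law D.carrier δ (a δ) (b δ)
          ((fun γ : SAW.DomainSAW D.carrier δ (a δ) (b δ) => γ.curve) ⁻¹' (A m)ᶜ)
        ≤ ∑' m, ε * 2⁻¹ ^ (m + 1) := ENNReal.tsum_le_tsum hbound
    _ = ε := by
        rw [ENNReal.tsum_mul_left]
        simp_rw [pow_succ, ENNReal.tsum_mul_right, ENNReal.tsum_geometric, ENNReal.one_sub_inv_two,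
          inv_inv]
        rw [ENNReal.mul_inv_cancel (by norm_num) (by norm_num), mul_one]

/-! ### Lattice geometry: a `ℤ²` polyline is never a stretched honeycomb polyline -/

/-- No honeycomb edge is horizontal: adjacent vertices are of opposite types, so their ordinates
differ by `(√3/2)(n ± 1/3) ≠ 0`, `n ∈ ℤ`. [folklore] -/
theorem im_hexCenter_sub_ne_zero {p q : HexVertex} (h : hexGraph.Adj p q) :
    (hexCenter q - hexCenter p).im ≠ 0 := by
  obtain ⟨x, k⟩ := p
  obtain ⟨y, l⟩ := q
  have hkl : k ≠ l := fun hkl => not_hexGraph_adj_of_snd_eq_holds _ _ hkl h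
  rw [Complex.sub_im, hexCenter_im, hexCenter_im, ← sub_mul]
  refine mul_ne_zero (fun h0 => ?_) (by positivity)
  have key : (3 * (y 1 - x 1) : ℝ) = (k : ℕ) - (l : ℕ) := by linarith
  fin_cases k <;> fin_cases l
  · exact hkl rfl
  · have h3 : ((3 * (y 1 - x 1) : ℤ) : ℝ) = -1 := by push_cast; rw [key]; simp
    have h4 : (3 * (y 1 - x 1) : ℤ) = -1 := by exact_mod_cast h3
    omega
  · have h3 : ((3 * (y 1 - x 1) : ℤ) : ℝ) = 1 := by push_cast; rw [key]; simp
    have h4 : (3 * (y 1 - x 1) : ℤ) = 1 := by exact_mod_cast h3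
    omega
  · exact hkl rfl

/-- Of two consecutive honeycomb edges `u ∼ w₁ ∼ w₂` with `u ≠ w₂` at least one is not vertical:
every vertex has exactly one vertical edge (up face `(x,0)` ↔ down face `(x - e₁, 1)`).
[folklore] -/
theorem re_hexCenter_sub_ne_zero_or {u w₁ w₂ : HexVertex} (h₁ : hexGraph.Adj u w₁)
    (h₂ : hexGraph.Adj w₁ w₂) (hne : u ≠ w₂) :
    (hexCenter w₁ - hexCenter u).re ≠ 0 ∨ (hexCenter w₂ - hexCenter w₁).re ≠ 0 := by
  obtain ⟨x, k⟩ := w₁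
  obtain ⟨y, l⟩ := u
  obtain ⟨y', l'⟩ := w₂
  simp only [Complex.sub_re]
  fin_cases k
  · -- `w₁` is an up face; its neighbours are the down faces of the cells `x`, `x - e₀`, `x - e₁`
    have hl : l = 1 := by
      fin_cases l
      · exact absurd h₁ (not_hexGraph_adj_of_snd_eq_holds _ _ rfl)
      · rfl
    have hl' : l' = 1 := by
      fin_cases l'
      · exact absurd h₂ (not_hexGraph_adj_of_snd_eq_holds _ _ rfl)
      · rfl
    subst hl hl'
    rcases (hexGraph_adj_iff_of_snd_eq_zero_holds x y).1 h₁.symm with rfl | rfl | rfl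
    · left; rw [hexCenter_re, hexCenter_re]; simp; norm_num
    · left; rw [hexCenter_re, hexCenter_re]; simp; intro h; linarith
    · rcases (hexGraph_adj_iff_of_snd_eq_zero_holds x y').1 h₂ with rfl | rfl | rfl
      · right; rw [hexCenter_re, hexCenter_re]; simp; norm_num
      · right; rw [hexCenter_re, hexCenter_re]; simp; intro h; linarith
      · exact absurd rfl hne
  · -- `w₁` is a down face; its neighbours are the up faces of the cells `x`, `x + e₀`, `x + e₁`
    have hl : l = 0 := by
      fin_cases l
      · rfl
      · exact absurd h₁ (not_hexGraph_adj_of_snd_eq_holds _ _ rfl)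
    have hl' : l' = 0 := by
      fin_cases l'
      · rfl
      · exact absurd h₂ (not_hexGraph_adj_of_snd_eq_holds _ _ rfl)
    subst hl hl'
    rcases (hexGraph_adj_iff_of_snd_eq_one x y).1 h₁.symm with rfl | rfl | rfl
    · left; rw [hexCenter_re, hexCenter_re]; simp; norm_num
    · left; rw [hexCenter_re, hexCenter_re]; simp; intro h; linarith
    · rcases (hexGraph_adj_iff_of_snd_eq_one x y').1 h₂ with rfl | rfl | rfl
      · right; rw [hexCenter_re, hexCenter_re]; simp; norm_num
      · right; rw [hexCenter_re, hexCenter_re]; simp; intro h; linarith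
      · exact absurd rfl hne

/-- A non-degenerate segment `{P + t d : t ∈ [0,1]}` which is neither horizontal nor vertical
(`d.re ≠ 0`, `d.im ≠ 0`) is not contained in the grid lines of any square mesh: it meets each of
the countably many lines at most once, and `[0, 1]` is not countable (it has Lebesgue measure `1`).
[folklore] -/
theorem not_forall_mem_gridLines {P d : ℂ} (hre : d.re ≠ 0) (him : d.im ≠ 0) (δ : ℝ) :
    ¬ ∀ t ∈ Set.Icc (0 : ℝ) 1, P + (t : ℂ) * d ∈ Mesh.gridLines δ := by
  intro h
  have hcount : (Set.Icc (0 : ℝ) 1).Countable := by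
    have hsub : Set.Icc (0 : ℝ) 1 ⊆ (⋃ n : ℤ, {t : ℝ | P.re + t * d.re = δ * n}) ∪
        ⋃ n : ℤ, {t : ℝ | P.im + t * d.im = δ * n} := by
      intro t ht
      rcases h t ht with ⟨n, hn⟩ | ⟨n, hn⟩
      · refine Or.inl (Set.mem_iUnion.2 ⟨n, ?_⟩)
        simpa using hn
      · refine Or.inr (Set.mem_iUnion.2 ⟨n, ?_⟩)
        simpa using hn
    refine Set.Countable.mono hsub ((Set.countable_iUnion fun n => ?_).union
      (Set.countable_iUnion fun n => ?_))
    · exact Set.Subsingleton.countable fun t ht t' ht' => mul_right_cancel₀ hre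
        (by rw [Set.mem_setOf_eq] at ht ht'; linarith)
    · exact Set.Subsingleton.countable fun t ht t' ht' => mul_right_cancel₀ him
        (by rw [Set.mem_setOf_eq] at ht ht'; linarith)
  have h0 := hcount.measure_zero (volume : Measure ℝ)
  rw [Real.volume_Icc] at h0
  norm_num at h0

/-- The trace of the polyline of a `δℤ²` walk lies on the grid lines of `δℤ²` (every step is a
unit axis-parallel segment between mesh points). [folklore] -/
theorem range_curve_subset_gridLines {Ω : Set ℂ} {δ : ℝ} {u v : Site 2}
    (γ : SAW.DomainSAW Ω δ u v) : γ.curve.range ⊆ Mesh.gridLines δ := by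
  show Set.range (γ.walk.toCurve (meshPoint δ)) ⊆ _
  refine SimpleGraph.Walk.range_toCurve_subset γ.walk (Mesh.meshPoint_mem_gridLines δ u)
    fun d _ => Mesh.segment_meshPoint_subset_gridLines δ ?_
  exact meshGraph_le_zdGraph Ω δ (discreteDomainGraph_adj_iff.1 d.adj).1

/-- **A `ℤ²` SAW class is never the image of a honeycomb SAW class with at least two steps under a
diagonal map `Φ = diag(r₁, r₂)`.** Of the first two honeycomb edges one is not vertical, and none
is horizontal, so the `Φ`-image of the honeycomb trace contains a segment that is neither
horizontal nor vertical, whereas the `ℤ²` trace lies on grid lines; traces are class invariants.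
(`≥ 2` steps is forced here by: endpoints distinct and not adjacent.) [folklore] -/
theorem map_curve_ne_curve {Φ : ℂ ≃ₜ ℂ} {r₁ r₂ : ℝ}
    (hΦ : ∀ z : ℂ, Φ z = ((r₁ * z.re : ℝ) : ℂ) + ((r₂ * z.im : ℝ) : ℂ) * Complex.I)
    (hr₁ : r₁ ≠ 0) (hr₂ : r₂ ≠ 0) {Ω : Set ℂ} {δ : ℝ} {u v : Site 2} (γ : SAW.DomainSAW Ω δ u v)
    {Ω' : Set ℂ} {δ' : ℝ} (hδ' : δ' ≠ 0) {u' v' : HexVertex} (hne : u' ≠ v')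
    (hnadj : ¬ hexGraph.Adj u' v') (γ' : SAW.HexDomainSAW Ω' δ' u' v') :
    CurveClass.map (Φ : C(ℂ, ℂ)) γ'.curve ≠ γ.curve := by
  intro heq
  obtain ⟨w, hw⟩ := γ'
  -- the honeycomb walk has at least two steps `u' → w₁ → w₂`
  cases w with
  | nil => exact hne rfl
  | @cons _ w₁ _ h₁ w =>
  cases w with
  | nil => exact hnadj (SAW.embDomainGraph_le _ _ _ _ h₁)
  | @cons _ w₂ _ h₂ p₂ =>
  have hG₁ : hexGraph.Adj u' w₁ := SAW.embDomainGraph_le _ _ _ _ h₁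
  have hG₂ : hexGraph.Adj w₁ w₂ := SAW.embDomainGraph_le _ _ _ _ h₂
  have hu2 : u' ≠ w₂ := by
    intro h
    have := ((SimpleGraph.Walk.cons_isPath_iff _ _).1 hw).2
    rw [h, SimpleGraph.Walk.support_cons] at this
    exact this (List.mem_cons_of_mem _ (SimpleGraph.Walk.start_mem_support _))
  -- traces: the `Φ`-image of the honeycomb trace lies on the grid lines of `δℤ²`
  have hR : ∀ z ∈ Set.range ((SimpleGraph.Walk.cons h₁ (SimpleGraph.Walk.cons h₂ p₂)).toCurve
      fun q => (δ' : ℂ) * hexCenter q), Φ z ∈ Mesh.gridLines δ := by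
    have h' : (Φ : C(ℂ, ℂ)) '' (SAW.EmbDomainSAW.curve
        ⟨SimpleGraph.Walk.cons h₁ (SimpleGraph.Walk.cons h₂ p₂), hw⟩).range ⊆ Mesh.gridLines δ := by
      rw [← CurveClass.range_map, heq]
      exact range_curve_subset_gridLines γ
    exact fun z hz => h' ⟨z, hz, rfl⟩
  have hrange : Set.range ((SimpleGraph.Walk.cons h₁ (SimpleGraph.Walk.cons h₂ p₂)).toCurve
      fun q => (δ' : ℂ) * hexCenter q) =
      segment ℝ ((δ' : ℂ) * hexCenter u') ((δ' : ℂ) * hexCenter w₁) ∪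
        (segment ℝ ((δ' : ℂ) * hexCenter w₁) ((δ' : ℂ) * hexCenter w₂) ∪
          Set.range (p₂.toCurve fun q => (δ' : ℂ) * hexCenter q)) := by
    rw [SimpleGraph.Walk.range_toCurve_cons, SimpleGraph.Walk.range_toCurve_cons]
  -- a non-vertical edge whose rescaled segment lies in the trace is contradictory
  have key : ∀ p q : HexVertex, hexGraph.Adj p q → (hexCenter q - hexCenter p).re ≠ 0 →
      segment ℝ ((δ' : ℂ) * hexCenter p) ((δ' : ℂ) * hexCenter q) ⊆
        Set.range ((SimpleGraph.Walk.cons h₁ (SimpleGraph.Walk.cons h₂ p₂)).toCurve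
          fun q => (δ' : ℂ) * hexCenter q) → False := by
    intro p q hpq hpre hseg
    set A : ℂ := (δ' : ℂ) * hexCenter p with hAdef
    set B : ℂ := (δ' : ℂ) * hexCenter q with hBdef
    have hdre : (Φ B - Φ A).re = r₁ * (δ' * (hexCenter q - hexCenter p).re) := by
      rw [hΦ, hΦ, hAdef, hBdef]; simp; ring
    have hdim : (Φ B - Φ A).im = r₂ * (δ' * (hexCenter q - hexCenter p).im) := by
      rw [hΦ, hΦ, hAdef, hBdef]; simp; ring
    refine not_forall_mem_gridLines (P := Φ A) (d := Φ B - Φ A)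
      (by rw [hdre]; exact mul_ne_zero hr₁ (mul_ne_zero hδ' hpre))
      (by rw [hdim]; exact mul_ne_zero hr₂ (mul_ne_zero hδ' (im_hexCenter_sub_ne_zero hpq)))
      δ fun t ht => ?_
    have hmem : A + (t : ℂ) * (B - A) ∈ segment ℝ A B := by
      rw [segment_eq_image']
      exact ⟨t, ht, by show A + t • (B - A) = _; rw [Complex.real_smul]⟩
    have h2 : Φ (A + (t : ℂ) * (B - A)) = Φ A + (t : ℂ) * (Φ B - Φ A) := by
      simp only [hΦ]
      apply Complex.ext <;> simp <;> ring
    rw [← h2]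
    exact hR _ (hseg hmem)
  rcases re_hexCenter_sub_ne_zero_or hG₁ hG₂ hu2 with hpre | hpre
  · exact key u' w₁ hG₁ hpre (by rw [hrange]; exact Set.subset_union_left)
  · exact key w₁ w₂ hG₂ hpre
      (by rw [hrange]; exact Set.subset_union_left.trans Set.subset_union_right)

end Summit.CriticalPhenomena.SAWScalingLimit.Cruxes.ModulusUniversality.Birth

end
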